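import Summits.Parity.GeneralizedHardyLittlewood.Theorems.PrimeLevelFamEdgeMomentsBeyondDiagonalDiagDecorOrderZeroTwoPoly
import HarnessLib

/-!
# Route `PrimeLevelFamEdge`, crux K_A `MomentsBeyondDiagonal` (stmt-Parity-20007), line «petersson_layers» v4, stub `stub_diag`:
# **order `(2,2)`: the real-inequality BOOKKEEPING of the twenty monomials of the polynomial part** (companion of
# `…DiagDecorOrderTwoTwoPoly`, which feeds the sixteen landed engine instances and the four `M₄`-family bounds into it)

The polynomial weight of order `(2,2)` (`…DiagDecorOrderTwoTwoHecke.selbergOrderTwoTwo_split`, p828453) is the sum of twenty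
monomials `cᵢ·(decorated block)`. Each engine delivers `|Sᵢ − KΦᵢℓ^{a}ℓ/ℓ^{b}| ≤ Cᵢℓ^{a}/ℓ^{b}` (`ℓ = log M`); the pieces with
`a = b + 1` are the top-degree ones (main order `ℓ²`), those with `a ≤ b` are `O(ℓ)`. This file is pure bookkeeping:

* `poly22_piece_main`, `poly22_piece_low`, `poly22_piece_hyp`, `poly22_add_piece` — one piece / adding pieces;
* `orderTwoTwo_combine` — **the twenty pieces together: main term `K(Φ₅/160 − Ψ₃/24 + (3/16)Ξ₁)ℓ²`, error `(Σ|cᵢ|·…)·ℓ`**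
  (the order-`(2,2)` analogue of `…DiagDecorOrderZeroTwoPoly.orderZeroTwo_combine`).

Def-free; theorems only (elementary real inequalities). Helper `--supports stmt-Parity-20007`; closes nothing; K_A, K_B and the
Parity summit are NOT proved; nothing about Landau–Siegel zeros.

## References
* E. Kowalski, P. Michel, J. VanderKam, J. reine angew. Math. 526 (2000), (23)–(28) pp. 13–15 and Prop. 5.1 p. 18.
  [cite: KowalskiMichelVanderKam2000, (23)–(28) — derivation (bookkeeping of the order-(2,2) diagonal main term)]
-/

noncomputable section

namespace Summit.Parity.GeneralizedHardyLittlewood.Theorems.MomentsBeyondDiagonal.DiagKernel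

/-! ### Bookkeeping lemmas -/

/-- A top-degree piece: `|S − KΦℓ^aℓ/ℓ^b| ≤ Cℓ^a/ℓ^b` with `a = b+1` gives `|cS − cKΦℓ²| ≤ |c|Cℓ`. [folklore] -/
theorem poly22_piece_main {S K Φ C ℓ : ℝ} (c : ℝ) {a b : ℕ} (hℓ : 1 ≤ ℓ) (hab : a = b + 1)
    (h : |S - K * Φ * ℓ ^ a * ℓ / ℓ ^ b| ≤ C * ℓ ^ a / ℓ ^ b) :
    |c * S - c * (K * Φ) * ℓ ^ 2| ≤ |c| * C * ℓ := by
  subst hab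
  have hℓ0 : 0 < ℓ := by linarith
  have e1 : K * Φ * ℓ ^ (b + 1) * ℓ / ℓ ^ b = K * Φ * ℓ ^ 2 := by
    rw [div_eq_iff (pow_ne_zero _ hℓ0.ne')]; ring
  have e2 : C * ℓ ^ (b + 1) / ℓ ^ b = C * ℓ := by
    rw [div_eq_iff (pow_ne_zero _ hℓ0.ne')]; ring
  rw [e1, e2] at h
  rw [show c * S - c * (K * Φ) * ℓ ^ 2 = c * (S - K * Φ * ℓ ^ 2) by ring, abs_mul]
  calc |c| * |S - K * Φ * ℓ ^ 2| ≤ |c| * (C * ℓ) := mul_le_mul_of_nonneg_left h (abs_nonneg c)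
    _ = |c| * C * ℓ := by ring

/-- A lower-degree piece: `|S − KΦℓ^aℓ/ℓ^b| ≤ Cℓ^a/ℓ^b` with `a ≤ b` gives `|cS − 0·ℓ²| ≤ |c|(K|Φ|+C)ℓ` (`ℓ ≥ 1`). [folklore] -/
theorem poly22_piece_low {S K Φ C ℓ : ℝ} (c : ℝ) {a b : ℕ} (hℓ : 1 ≤ ℓ) (hK : 0 ≤ K) (hC : 0 ≤ C) (hab : a ≤ b)
    (h : |S - K * Φ * ℓ ^ a * ℓ / ℓ ^ b| ≤ C * ℓ ^ a / ℓ ^ b) :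
    |c * S - 0 * ℓ ^ 2| ≤ |c| * (K * |Φ| + C) * ℓ := by
  have hℓ0 : 0 < ℓ := by linarith
  have hr : ℓ ^ a / ℓ ^ b ≤ 1 := by
    rw [div_le_one (pow_pos hℓ0 _)]; exact pow_le_pow_right₀ hℓ hab
  have hr0 : 0 ≤ ℓ ^ a / ℓ ^ b := by positivity
  have h1 : |K * Φ * ℓ ^ a * ℓ / ℓ ^ b| ≤ K * |Φ| * ℓ := by
    rw [show K * Φ * ℓ ^ a * ℓ / ℓ ^ b = K * Φ * ℓ * (ℓ ^ a / ℓ ^ b) by ring, abs_mul, abs_of_nonneg hr0,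
      abs_mul, abs_mul, abs_of_nonneg hK, abs_of_pos hℓ0]
    calc K * |Φ| * ℓ * (ℓ ^ a / ℓ ^ b) ≤ K * |Φ| * ℓ * 1 := by gcongr
      _ = K * |Φ| * ℓ := mul_one _
  have h2 : C * ℓ ^ a / ℓ ^ b ≤ C * ℓ := by
    rw [mul_div_assoc]
    calc C * (ℓ ^ a / ℓ ^ b) ≤ C * 1 := by gcongr
      _ ≤ C * ℓ := by rw [mul_one]; exact le_mul_of_one_le_right hC hℓ
  have hS : |S| ≤ (K * |Φ| + C) * ℓ := by
    calc |S| = |(S - K * Φ * ℓ ^ a * ℓ / ℓ ^ b) + K * Φ * ℓ ^ a * ℓ / ℓ ^ b| := by congr 1; ring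
      _ ≤ |S - K * Φ * ℓ ^ a * ℓ / ℓ ^ b| + |K * Φ * ℓ ^ a * ℓ / ℓ ^ b| := abs_add_le _ _
      _ ≤ C * ℓ ^ a / ℓ ^ b + K * |Φ| * ℓ := add_le_add h h1
      _ ≤ C * ℓ + K * |Φ| * ℓ := by linarith
      _ = (K * |Φ| + C) * ℓ := by ring
  rw [zero_mul, sub_zero, abs_mul]
  calc |c| * |S| ≤ |c| * ((K * |Φ| + C) * ℓ) := mul_le_mul_of_nonneg_left hS (abs_nonneg c)
    _ = |c| * (K * |Φ| + C) * ℓ := by ring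

/-- A hypothesis piece: `|S| ≤ Cℓ` gives `|cS − 0·ℓ²| ≤ |c|Cℓ`. [folklore] -/
theorem poly22_piece_hyp {S C ℓ : ℝ} (c : ℝ) (h : |S| ≤ C * ℓ) : |c * S - 0 * ℓ ^ 2| ≤ |c| * C * ℓ := by
  rw [zero_mul, sub_zero, abs_mul]
  calc |c| * |S| ≤ |c| * (C * ℓ) := mul_le_mul_of_nonneg_left h (abs_nonneg c)
    _ = |c| * C * ℓ := by ring

/-- Adding two pieces. [folklore] -/
theorem poly22_add_piece {x₁ x₂ m₁ m₂ d₁ d₂ : ℝ} (h₁ : |x₁ - m₁| ≤ d₁) (h₂ : |x₂ - m₂| ≤ d₂) :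
    |x₁ + x₂ - (m₁ + m₂)| ≤ d₁ + d₂ := by
  calc |x₁ + x₂ - (m₁ + m₂)| = |(x₁ - m₁) + (x₂ - m₂)| := by congr 1; ring
    _ ≤ |x₁ - m₁| + |x₂ - m₂| := abs_add_le _ _
    _ ≤ d₁ + d₂ := add_le_add h₁ h₂

/-- **The bookkeeping of the twenty pieces at order `(2,2)`** (`K = (π²/6)²`, `ℓ = log M ≥ 1`): four top-degree pieces
(`S₅`, `T₃`, `T₃'`, `U₁`) carry the main term `K(Φ₅/160 − Ψ₃/24 + (3/16)Ξ₁)ℓ²`, the other sixteen are `O(ℓ)`. [folklore] -/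
theorem orderTwoTwo_combine
    {S₅ S₄ S₃ S₂ S₁ S₀ T₃ T₃' T₂ T₂' T₁ T₁' T₀ T₀' U₁ U₀ V₁ W₁ V₀ W₀ : ℝ}
    {Φ₅ Φ₄ Φ₃ Φ₂ Φ₁ Φ₀ Ψ₃ Ψ₂ Ψ₁ Ψ₀ Ξ₁ Ξ₀ : ℝ}
    {C₅ C₄ C₃ C₂ C₁ C₀ D₃ D₃' D₂ D₂' D₁ D₁' D₀ D₀' G₁ G₀ A₁ B₁ A₀ B₀ : ℝ}
    {E₀₀ E₀₁ E₁₀ E₀₂ E₂₀ E₁₁ E₁₂ E₂₁ E₂₂ μ₂ μ₄ ℓ K : ℝ} (hℓ : 1 ≤ ℓ) (hK : 0 ≤ K)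
    (hC₄ : 0 ≤ C₄) (hC₃ : 0 ≤ C₃) (hC₂ : 0 ≤ C₂) (hC₁ : 0 ≤ C₁) (hC₀ : 0 ≤ C₀) (hD₂ : 0 ≤ D₂) (hD₂' : 0 ≤ D₂') (hD₁ : 0 ≤ D₁) (hD₁' : 0 ≤ D₁') (hD₀ : 0 ≤ D₀) (hD₀' : 0 ≤ D₀') (hG₀ : 0 ≤ G₀)
    (h5 : |S₅ - K * Φ₅ * ℓ ^ 5 * ℓ / ℓ ^ 4| ≤ C₅ * ℓ ^ 5 / ℓ ^ 4)
    (h4 : |S₄ - K * Φ₄ * ℓ ^ 4 * ℓ / ℓ ^ 4| ≤ C₄ * ℓ ^ 4 / ℓ ^ 4)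
    (h3 : |S₃ - K * Φ₃ * ℓ ^ 3 * ℓ / ℓ ^ 4| ≤ C₃ * ℓ ^ 3 / ℓ ^ 4)
    (h2 : |S₂ - K * Φ₂ * ℓ ^ 2 * ℓ / ℓ ^ 4| ≤ C₂ * ℓ ^ 2 / ℓ ^ 4)
    (h1 : |S₁ - K * Φ₁ * ℓ ^ 1 * ℓ / ℓ ^ 4| ≤ C₁ * ℓ ^ 1 / ℓ ^ 4)
    (h0 : |S₀ - K * Φ₀ * ℓ ^ 0 * ℓ / ℓ ^ 4| ≤ C₀ * ℓ ^ 0 / ℓ ^ 4)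
    (g3 : |T₃ - K * Ψ₃ * ℓ ^ 3 * ℓ / ℓ ^ 2| ≤ D₃ * ℓ ^ 3 / ℓ ^ 2)
    (g3p : |T₃' - K * Ψ₃ * ℓ ^ 3 * ℓ / ℓ ^ 2| ≤ D₃' * ℓ ^ 3 / ℓ ^ 2)
    (g2 : |T₂ - K * Ψ₂ * ℓ ^ 2 * ℓ / ℓ ^ 2| ≤ D₂ * ℓ ^ 2 / ℓ ^ 2)
    (g2p : |T₂' - K * Ψ₂ * ℓ ^ 2 * ℓ / ℓ ^ 2| ≤ D₂' * ℓ ^ 2 / ℓ ^ 2)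
    (g1 : |T₁ - K * Ψ₁ * ℓ ^ 1 * ℓ / ℓ ^ 2| ≤ D₁ * ℓ ^ 1 / ℓ ^ 2)
    (g1p : |T₁' - K * Ψ₁ * ℓ ^ 1 * ℓ / ℓ ^ 2| ≤ D₁' * ℓ ^ 1 / ℓ ^ 2)
    (g0 : |T₀ - K * Ψ₀ * ℓ ^ 0 * ℓ / ℓ ^ 2| ≤ D₀ * ℓ ^ 0 / ℓ ^ 2)
    (g0p : |T₀' - K * Ψ₀ * ℓ ^ 0 * ℓ / ℓ ^ 2| ≤ D₀' * ℓ ^ 0 / ℓ ^ 2)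
    (u1 : |U₁ - K * Ξ₁ * ℓ ^ 1 * ℓ / ℓ ^ 0| ≤ G₁ * ℓ ^ 1 / ℓ ^ 0)
    (u0 : |U₀ - K * Ξ₀ * ℓ ^ 0 * ℓ / ℓ ^ 0| ≤ G₀ * ℓ ^ 0 / ℓ ^ 0)
    (a1 : |V₁| ≤ A₁ * ℓ)
    (b1 : |W₁| ≤ B₁ * ℓ)
    (a0 : |V₀| ≤ A₀ * ℓ)
    (b0 : |W₀| ≤ B₀ * ℓ) :
    |(1 / 160 * S₅ +
        E₀₀ / 16 * S₄ +
        ((E₀₁ + E₁₀) / 4 - μ₂ / 3) * S₃ +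
        ((E₀₂ + E₂₀) / 4 + E₁₁) * S₂ +
        (2 * μ₄ + E₁₂ + E₂₁) * S₁ +
        E₂₂ * S₀ +
        (-1 / 48) * T₃ +
        (-1 / 48) * T₃' +
        (-E₀₀ / 8) * T₂ +
        (-E₀₀ / 8) * T₂' +
        (3 * μ₂ - (E₀₁ + E₁₀) / 4) * T₁ +
        (3 * μ₂ - (E₀₁ + E₁₀) / 4) * T₁' +
        ((E₀₂ + E₂₀) / 4 - E₁₁) * T₀ +
        ((E₀₂ + E₂₀) / 4 - E₁₁) * T₀' +
        3 / 16 * U₁ +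
        3 * E₀₀ / 8 * U₀ +
        1 / 32 * V₁ +
        1 / 32 * W₁ +
        E₀₀ / 16 * V₀ +
        E₀₀ / 16 * W₀) -
        K * (Φ₅ / 160 - Ψ₃ / 24 + 3 / 16 * Ξ₁) * ℓ ^ 2| ≤
      (|(1 / 160 : ℝ)| * C₅ +
        |(E₀₀ / 16 : ℝ)| * (K * |Φ₄| + C₄) +
        |(((E₀₁ + E₁₀) / 4 - μ₂ / 3) : ℝ)| * (K * |Φ₃| + C₃) +
        |(((E₀₂ + E₂₀) / 4 + E₁₁) : ℝ)| * (K * |Φ₂| + C₂) +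
        |((2 * μ₄ + E₁₂ + E₂₁) : ℝ)| * (K * |Φ₁| + C₁) +
        |(E₂₂ : ℝ)| * (K * |Φ₀| + C₀) +
        |((-1 / 48) : ℝ)| * D₃ +
        |((-1 / 48) : ℝ)| * D₃' +
        |((-E₀₀ / 8) : ℝ)| * (K * |Ψ₂| + D₂) +
        |((-E₀₀ / 8) : ℝ)| * (K * |Ψ₂| + D₂') +
        |((3 * μ₂ - (E₀₁ + E₁₀) / 4) : ℝ)| * (K * |Ψ₁| + D₁) +
        |((3 * μ₂ - (E₀₁ + E₁₀) / 4) : ℝ)| * (K * |Ψ₁| + D₁') +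
        |(((E₀₂ + E₂₀) / 4 - E₁₁) : ℝ)| * (K * |Ψ₀| + D₀) +
        |(((E₀₂ + E₂₀) / 4 - E₁₁) : ℝ)| * (K * |Ψ₀| + D₀') +
        |(3 / 16 : ℝ)| * G₁ +
        |(3 * E₀₀ / 8 : ℝ)| * (K * |Ξ₀| + G₀) +
        |(1 / 32 : ℝ)| * A₁ +
        |(1 / 32 : ℝ)| * B₁ +
        |(E₀₀ / 16 : ℝ)| * A₀ +
        |(E₀₀ / 16 : ℝ)| * B₀) * ℓ := by
  have q1 := poly22_piece_main (1 / 160 : ℝ) hℓ rfl h5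
  have q2 := poly22_piece_low (E₀₀ / 16 : ℝ) hℓ hK hC₄ (by norm_num) h4
  have q3 := poly22_piece_low (((E₀₁ + E₁₀) / 4 - μ₂ / 3) : ℝ) hℓ hK hC₃ (by norm_num) h3
  have q4 := poly22_piece_low (((E₀₂ + E₂₀) / 4 + E₁₁) : ℝ) hℓ hK hC₂ (by norm_num) h2
  have q5 := poly22_piece_low ((2 * μ₄ + E₁₂ + E₂₁) : ℝ) hℓ hK hC₁ (by norm_num) h1
  have q6 := poly22_piece_low (E₂₂ : ℝ) hℓ hK hC₀ (by norm_num) h0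
  have q7 := poly22_piece_main ((-1 / 48) : ℝ) hℓ rfl g3
  have q8 := poly22_piece_main ((-1 / 48) : ℝ) hℓ rfl g3p
  have q9 := poly22_piece_low ((-E₀₀ / 8) : ℝ) hℓ hK hD₂ (by norm_num) g2
  have q10 := poly22_piece_low ((-E₀₀ / 8) : ℝ) hℓ hK hD₂' (by norm_num) g2p
  have q11 := poly22_piece_low ((3 * μ₂ - (E₀₁ + E₁₀) / 4) : ℝ) hℓ hK hD₁ (by norm_num) g1
  have q12 := poly22_piece_low ((3 * μ₂ - (E₀₁ + E₁₀) / 4) : ℝ) hℓ hK hD₁' (by norm_num) g1p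
  have q13 := poly22_piece_low (((E₀₂ + E₂₀) / 4 - E₁₁) : ℝ) hℓ hK hD₀ (by norm_num) g0
  have q14 := poly22_piece_low (((E₀₂ + E₂₀) / 4 - E₁₁) : ℝ) hℓ hK hD₀' (by norm_num) g0p
  have q15 := poly22_piece_main (3 / 16 : ℝ) hℓ rfl u1
  have q16 := poly22_piece_low (3 * E₀₀ / 8 : ℝ) hℓ hK hG₀ (by norm_num) u0
  have q17 := poly22_piece_hyp (1 / 32 : ℝ) a1
  have q18 := poly22_piece_hyp (1 / 32 : ℝ) b1
  have q19 := poly22_piece_hyp (E₀₀ / 16 : ℝ) a0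
  have q20 := poly22_piece_hyp (E₀₀ / 16 : ℝ) b0
  have H2 := poly22_add_piece q1 q2
  have H3 := poly22_add_piece H2 q3
  have H4 := poly22_add_piece H3 q4
  have H5 := poly22_add_piece H4 q5
  have H6 := poly22_add_piece H5 q6
  have H7 := poly22_add_piece H6 q7
  have H8 := poly22_add_piece H7 q8
  have H9 := poly22_add_piece H8 q9
  have H10 := poly22_add_piece H9 q10
  have H11 := poly22_add_piece H10 q11
  have H12 := poly22_add_piece H11 q12
  have H13 := poly22_add_piece H12 q13
  have H14 := poly22_add_piece H13 q14
  have H15 := poly22_add_piece H14 q15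
  have H16 := poly22_add_piece H15 q16
  have H17 := poly22_add_piece H16 q17
  have H18 := poly22_add_piece H17 q18
  have H19 := poly22_add_piece H18 q19
  have H := poly22_add_piece H19 q20
  have hm : ∀ {x m₁ m₂ d : ℝ}, m₁ = m₂ → |x - m₁| ≤ d → |x - m₂| ≤ d := fun e h ↦ e ▸ h
  refine (hm ?_ H).trans (le_of_eq ?_)
  · ring
  · ring

end Summit.Parity.GeneralizedHardyLittlewood.Theorems.MomentsBeyondDiagonal.DiagKernel

end
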